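import Summits.QuantumFields.YangMills.Theorems.BalabanUVNodesN11Sect3SupplyChainBorelBThm1PrintedOfLogScalars
import Summits.QuantumFields.YangMills.Theorems.BalabanUVNodesN11RunGuardIsCouplingFloor

/-!
# DAG node N11 — THE BorelB ROAD ABOVE THE COUPLING FLOOR: N11's token and THEOREM 1 of [III] ON EVERY WINDOW RUN WHOSE LAST COUPLING CLEARS THE FLOOR
# `log(1∕g_K² + B) ≤ L^(m−a)` (β of record `≤ B` along the run, `M = L^a`, `r = 1`) — the run guard `PartCompat₁₃` DISCHARGED by dag-n11-w4's floor producer; the ∀-RUN statement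
# the road CAN deliver («the compatible half», plan g85 WORD-2 (b)), complementary to the one-block half (BG-ONEBLOCK, road (α))

HEADER — WORK-UNIT METADATA.  Cell `pub-ymgap`, YM-PLAN Track A (HUMAN RULING D-0062 ∕ D-0149 width seats), seat `pub-ymgap-dag-n11-w1` (g3; WIDTH SEAT 1 of 4 on NODE n11
[B14]), route `BalabanUVNodes` rev 27 (Variant R), KEY item K1⁸ `StabilityBRunRowsAtRecordR13SepCoPH` = stmt-QuantumFields-26907 (helper lane, `--kind proof --supports 26907
--as helper`, count-neutral).  This seat's ASK-NEXT offer (o6) (pub-ymgap INBOX 2026-08-28T08:57Z), GO by plan g85 WORD-2 (b) (INBOX 2026-08-28T09:12:57Z: «n11-w1 (o6) GO STANDS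
— the ∀ window run ABOVE the floor ⟹ SLaw statement is the COMPATIBLE half print literally sets up; BG-ONEBLOCK is its complement»).  [III] = [Balaban1988Convergent], [I] =
[Balaban1987RG1], [V] = [Balaban1989LargeFieldII], [15] = [Balaban1985Variational].  Over this seat's E `…Sect3SupplyChainBorelBThm1PrintedOfLogScalars` (p613848:
`supplyChainAt_of_gaussCert_of_supplierBorel_of_nesting_of_logScalars`), dag-n11-w4's `…N11RunGuardIsCouplingFloor` (p615408: `partCompat₁₃_of_window_of_betaLe_of_floor`), dag-n11-e's
`…Sect3SupplyChainObligationsDefs` (`sLaw₁₃CoPH_all_of_supplyChainAt`, `thmP245Laws_of_supplyChainAt`).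

WHY THIS FILE.  The printed faces of this seat's files B–E read the binder `∀ P, window → PartCompat₁₃ θ P P.K`, which dag-n11-w4 g4 showed UNSATISFIABLE at every `γ` (tiny bare
couplings stay in the window and leave the last 𝐃-cube bigger than the torus) and located as a FLOOR on the last coupling: on (0.20)-runs with β of record `≤ B`, `PartCompat₁₃ θ P`
⟺ `log(1∕g_K² + B) ≤ L^(m−a)` up to constants (p615408 §2).  The plan (g85 WORD-2) priced the «hole below the floor» as SCOPE∕SUPPLY: above the floor the tree's N11 machinery
applies as is (the compatible half, this file); below it the partition of record is one-block and the background-regularity content must come from a located supplier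
(BG-ONEBLOCK; this seat's `…OfBgFact(s)` editions are its consumer side).  THIS FILE types the compatible half for the BorelB road: (§1) per run — the token `SupplyChainAt θ p`
at any Gaussian-class `θ` from E's rows with `hPC` REPLACED by the three floor letters (`M = L^a ∧ r = 1 ∧ a ≤ m`, β of record `≤ B` along the run, the floor on `g_K`); (§2) the
∀-RUN statements: THEOREM 1 of [III] (`∀ k ≤ K, SLaw₁₃CoPH θ P k`) and the p. 245 laws on EVERY window run above the floor, per run K0's per-cube [15]-solvability and [III] §3's
supplier (`SupplierObligations ∧ SupplierBorel`) displayed — NOT `B16.Thm1Printed` (whose window also holds the runs below the floor).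

WHAT THIS FILE PROVES (3 theorems, 0 `def`, 0 `sorry`; standard axioms; compositions BY NAME).
§1 ★★ `supplyChainAt_of_gaussCert_of_supplierBorel_of_logScalars_of_betaLe_of_floor`.
§2 ★★★ `sLaw₁₃CoPH_all_aboveFloor_of_gaussCert_of_supplierBorel_of_logScalars` · `thmP245Laws_aboveFloor_of_gaussCert_of_supplierBorel_of_logScalars`.

HONEST FRAMING.  Helper lane of K1⁸, count-neutral kernel bookkeeping; the β-ceiling along the run, the floor, the key, `2 ≤ cR` (uninhabited at the witnesses of record), K0's
solvability, the supplier and the scalar letters are DISPLAYED HYPOTHESES; nothing of Bałaban asserted; no statement about runs below the floor.  N11 NOT discharged; K1⁸ ∕ K1⁷ NOT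
closed, no registered stub touched; counts unmoved (typed 28∕28 · discharged 5∕27).  One finite `𝕋⁴_{L^K}` programme at fixed `ε = L^{−K}`; R4 closes only the conditional
finite-𝕋⁴ rung `BalabanLadder.UV` — NOT ℝ⁴, NOT OS, NOT a mass gap, NOT Clay.  No `sorry`, no `axiom`, no `def`, no `instance`, no `notation`.
Sources (SHAPE only): [III] Thm 1 p.262, Theorem p.245, §3 p.279, (2.1) p.254, (2.5) p.255, p.257, (2.28) p.259, (3.24)–(3.25) p.270; [I] (0.20) p.256, Thm 1 p.259, (1.20)–(1.22)
p.264; [V] Thm 1 p.355; [15] Thm 1 (7)–(8) pp.278–279.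
-/

noncomputable section

open MeasureTheory
open scoped BigOperators ENNReal NNReal Matrix.Norms.L2Operator

namespace Summit.QuantumFields.YangMills.Theorems.BalabanUVNodesN11Sect3SupplyChainBorelBAboveFloor

open Literature.MathematicalPhysics.QuantumFieldTheory.Balaban1983to89 T4Continuum T4NestedCovariance Node00 Node00.Tk DagBinding
open B15DeterminingSets B8Eq17ClassAkV1 B14.Eq218Concrete B10Eq42TorusConstraint Step
open B14.Eq213MaximalDomains (side)
open B14.Eq213DetSet (Bj)
open Literature.MathematicalPhysics.QuantumFieldTheory.BalabanImbrieJaffe1984to88.BIJ85Eq453GaugeField (qsstarGIter0)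
open FlowStep (prefixOf)
open BalabanUVNodesN11HistoryPinnedResidualDefs BalabanUVNodesN11RePinnedParamDefs
open BalabanUVNodesN11Sect3SupplyChainDefs
open BalabanUVNodesN11Sect3SupplyChainBorelB
open BalabanUVNodesN11Sect3SupplyChainObligationsDefs
open BalabanUVNodesN11Sect3SupplyChainBorelBThm1PrintedOfLogScalars (supplyChainAt_of_gaussCert_of_supplierBorel_of_nesting_of_logScalars)
open BalabanUVNodesN11RunGuardIsCouplingFloor (partCompat₁₃_of_window_of_betaLe_of_floor)

variable {F : T4Family} {N : ℕ} [NeZero N]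

section AboveFloor

variable (θ : Stage13HParams F N)

section PerRun

variable (p : B12.RunParams)

/-- **★★ N11's ONE-TOKEN RESIDUAL `SupplyChainAt θ p` ON A WINDOW RUN ABOVE THE COUPLING FLOOR — NO RUN GUARD DISPLAYED** (this seat's E face
`supplyChainAt_of_gaussCert_of_supplierBorel_of_nesting_of_logScalars` (p613848) with `hPC : PartCompat₁₃ … p p.K` DISCHARGED by dag-n11-w4's
`partCompat₁₃_of_window_of_betaLe_of_floor` (p615408)): at `M = L^a`, `r = 1`, `a ≤ m`, a run in the window `]0, θ.γ]` whose β of record stays `≤ B` along the run and whose LAST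
coupling clears the floor `log(1∕g_K² + B) ≤ L^(m−a)` IS partition-compatible at every level — «the compatible half print literally sets up» (plan g85 WORD-2 (b)); the other rows as
in E (`M₂`-light log scalars, `2 ≤ cR`, K0's per-cube [15]-solvability, `SupplierObligations ∧ SupplierBorel`). [cite: Balaban1988Convergent, Thm 1 p.262, Theorem p.245, §3 p.279, (2.1) p.254, (2.5) p.255, p.257, (2.28) p.259, (3.24)–(3.25) p.270; Balaban1987RG1, (0.20) p.256, Thm 1 p.259, (1.20)–(1.22) p.264; Balaban1985Variational, Thm 1 (7)–(8) pp.278–279] -/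
theorem supplyChainAt_of_gaussCert_of_supplierBorel_of_logScalars_of_betaLe_of_floor
    (hζ : ∀ (p' : B12.RunParams) (n : ℕ) (Ω Λ : ℕ → Set (Site (F.P p'.K) 0)), (θ.Zh p' n Ω Λ).ζ0 = (ZhPinOfRecord₁₃ θ.toStage13Params p' Ω Λ).ζ0)
    (hq : ∀ (p' : B12.RunParams) (n : ℕ) (Ω Λ : ℕ → Set (Site (F.P p'.K) 0)) (j : ℕ) (Λ' : Set (Site (F.P p'.K) 0)) (ω : MultiCfg (F.P p'.K) (SU N) (FluctV N)),
      (θ.Zh p' n Ω Λ).quad j Λ' ω = ∑ b ∈ (Set.toFinite (bondsIn j (Λ'ᶜ ∩ Ω (j + 1)))).toFinset, ‖(ω j).2 b‖ ^ 2)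
    (h : θ.Provisos₁₃SepCoPH F N) (hθ : θ.Admissible F N) (hM₁ : 0 < θ.ν.M₁) (hle : θ.ν.M₁ ≤ θ.τ9.M) (hcR : 2 ≤ θ.s2.cR) (hdiv : F.L * θ.ν.M₂ ∣ θ.τ9.M)
    (hM3 : (3 * θ.ν.M₁ : ℝ) ≤ F.L * θ.ν.M₂ * (Real.log (θ.γ ^ 2)⁻¹) ^ θ.ν.r)
    (hMd : (((4 + 4) * F.L + 3 : ℕ) : ℝ) ≤ F.L * θ.ν.M₂ * (Real.log (θ.γ ^ 2)⁻¹) ^ θ.ν.r)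
    (hA : 0 < θ.ν.A₀) (hγ1 : θ.γ < 1) (hγp : θ.γ ≤ Real.exp (-(θ.ν.p₀ : ℝ)))
    (hg3 : (143 * ((((8 : ℕ) : ℝ)) ^ 2 / 4) ^ 2) * (θ.γ * (θ.ν.A₀ * (Real.log (θ.γ ^ 2)⁻¹) ^ θ.ν.p₀)) ≤ 1 / 3)
    (hg2 : 2 * (θ.γ * (θ.ν.A₀ * (Real.log (θ.γ ^ 2)⁻¹) ^ θ.ν.p₀)) ≤ 2 * ExpMeanLog.deltaSU (Fin N) / (((8 * F.L : ℕ) : ℝ)) ^ 2)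
    {a : ℕ} (hMa : θ.τ9.M = F.L ^ a) (hr : θ.ν.r = 1) (ha : a ≤ F.m) {B : ℝ} (hB0 : 0 ≤ B)
    (hw : Step.InInterval θ.γ p.K (gOfRecord₁₃ F N θ.toStage13Params p))
    (hβ : ∀ j, j < p.K → betaOfRecord₁₃ F N θ.toStage13Params j (prefixOf (gOfRecord₁₃ F N θ.toStage13Params p) j) ≤ B)
    (hfloor : Real.log (1 / gOfRecord₁₃ F N θ.toStage13Params p p.K ^ 2 + B) ≤ ((F.L ^ (F.m - a) : ℕ) : ℝ))
    (hsolv : ∀ j, 1 ≤ j → j ≤ p.K →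
      ∀ (s : SeqOfRecord F θ.ν θ.τ9.M (gOfRecord₁₃ F N θ.toStage13Params p) p.K j) (V : GaugeField (F.P p.K) j (SU N)),
      chiSeqOfRecord F N θ.ν θ.τ9.M (gOfRecord₁₃ F N θ.toStage13Params p) p.K j s V ≠ 0 →
      ∀ a ∈ cubesIn (fun a : ↥(cubeIndices (F.P p.K) (cubeSide (F.P p.K).L θ.ν.M₂ (RkOfRecord (F.P p.K).L θ.ν.r (gOfRecord₁₃ F N θ.toStage13Params p j)) j)) =>
          cubeEnl (F.P p.K) (cubeSide (F.P p.K).L θ.ν.M₂ (RkOfRecord (F.P p.K).L θ.ν.r (gOfRecord₁₃ F N θ.toStage13Params p j)) j) a 0) (s.Ω j),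
        ∃ U₀, IsMinimizer (avOfRecord F N p.K) {U | PlaqSmall (θ.ν.εreg * (F.P p.K).eta j ^ 2) U}
          (Bj θ.ν.M₁ (cubeEnl (F.P p.K) (cubeSide (F.P p.K).L θ.ν.M₂ (RkOfRecord (F.P p.K).L θ.ν.r (gOfRecord₁₃ F N θ.toStage13Params p j)) j) a 4) j)
          (avgFamily (avOfRecord F N p.K) (qsstarGIter0 j V)) U₀)
    (σ : Sect3Supplier θ p) (hσ : SupplierObligations θ p σ) (hσB : SupplierBorel θ p σ) : SupplyChainAt θ p :=
  supplyChainAt_of_gaussCert_of_supplierBorel_of_nesting_of_logScalars θ p hζ hq h hθ hM₁ hle hcR hdiv hM3 hMd hA hγ1 hγp hg3 hg2 hw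
    (partCompat₁₃_of_window_of_betaLe_of_floor θ.toStage13Params hMa hr p ha hB0 hw hβ hfloor le_rfl) hsolv σ hσ hσB

end PerRun

/-- **★★★ THEOREM 1 OF [III] ON EVERY WINDOW RUN ABOVE THE COUPLING FLOOR — `∀ P` in `]0, θ.γ]` with β of record `≤ B` along `P` and `log(1∕g_K² + B) ≤ L^(m−a)`:
`∀ k ≤ K, SLaw₁₃CoPH θ P k`** (at any Gaussian-class `θ` on the live-selector line, `M = L^a`, `r = 1`; per run K0's per-cube [15]-solvability and [III] §3's supplier with
`SupplierBorel`).  This is the ∀-RUN statement the BorelB road CAN deliver — NOT `B16.Thm1Printed`, whose window also contains the runs BELOW the floor (dag-n11-w4 g4 p615408 ∕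
p617030: there the record's partition is one-block and the bg content must come from the located BG-ONEBLOCK supplier, plan g85 WORD-2 road (α); this seat's `…OfBgFact(s)` files
are that supplier's consumer side).  Via dag-n11-e's `sLaw₁₃CoPH_all_of_supplyChainAt` on §1's token. [cite: Balaban1988Convergent, Thm 1 p.262, Theorem p.245, §3 p.279, p.257, (3.24)–(3.25) p.270; Balaban1989LargeFieldII, Thm 1 p.355; Balaban1987RG1, (0.20) p.256, Thm 1 p.259; Balaban1989LargeFieldI, (0.2)–(0.4) p.176, p.177 (i)–(ii)] -/
theorem sLaw₁₃CoPH_all_aboveFloor_of_gaussCert_of_supplierBorel_of_logScalars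
    (hζ : ∀ (p' : B12.RunParams) (n : ℕ) (Ω Λ : ℕ → Set (Site (F.P p'.K) 0)), (θ.Zh p' n Ω Λ).ζ0 = (ZhPinOfRecord₁₃ θ.toStage13Params p' Ω Λ).ζ0)
    (hq : ∀ (p' : B12.RunParams) (n : ℕ) (Ω Λ : ℕ → Set (Site (F.P p'.K) 0)) (j : ℕ) (Λ' : Set (Site (F.P p'.K) 0)) (ω : MultiCfg (F.P p'.K) (SU N) (FluctV N)),
      (θ.Zh p' n Ω Λ).quad j Λ' ω = ∑ b ∈ (Set.toFinite (bondsIn j (Λ'ᶜ ∩ Ω (j + 1)))).toFinset, ‖(ω j).2 b‖ ^ 2)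
    (h : θ.Provisos₁₃SepCoPH F N)
    (hsel : θ.ppSel = ppSelLiveOfRecord F N θ.ν θ.τ9 (EOfRecord₁₃ F N θ.toStage13Params) (wOfRecord₉ F N θ.toStage9Params))
    (hθ : θ.Admissible F N) (hκ : 0 ≤ θ.s2.lf.κ) (hE₀ : 0 ≤ θ.s2.lf.E₀) (hB₀ : 0 ≤ θ.s2.lf.B₀)
    (hM₁ : 0 < θ.ν.M₁) (hle : θ.ν.M₁ ≤ θ.τ9.M) (hcR : 2 ≤ θ.s2.cR) (hdiv : F.L * θ.ν.M₂ ∣ θ.τ9.M)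
    (hM3 : (3 * θ.ν.M₁ : ℝ) ≤ F.L * θ.ν.M₂ * (Real.log (θ.γ ^ 2)⁻¹) ^ θ.ν.r)
    (hMd : (((4 + 4) * F.L + 3 : ℕ) : ℝ) ≤ F.L * θ.ν.M₂ * (Real.log (θ.γ ^ 2)⁻¹) ^ θ.ν.r)
    (hA : 0 < θ.ν.A₀) (hγ1 : θ.γ < 1) (hγp : θ.γ ≤ Real.exp (-(θ.ν.p₀ : ℝ)))
    (hg3 : (143 * ((((8 : ℕ) : ℝ)) ^ 2 / 4) ^ 2) * (θ.γ * (θ.ν.A₀ * (Real.log (θ.γ ^ 2)⁻¹) ^ θ.ν.p₀)) ≤ 1 / 3)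
    (hg2 : 2 * (θ.γ * (θ.ν.A₀ * (Real.log (θ.γ ^ 2)⁻¹) ^ θ.ν.p₀)) ≤ 2 * ExpMeanLog.deltaSU (Fin N) / (((8 * F.L : ℕ) : ℝ)) ^ 2)
    {a : ℕ} (hMa : θ.τ9.M = F.L ^ a) (hr : θ.ν.r = 1) (ha : a ≤ F.m) {B : ℝ} (hB0 : 0 ≤ B)
    (hsolv : ∀ P : B12.RunParams, Step.InInterval θ.γ P.K (gOfRecord₁₃ F N θ.toStage13Params P) → ∀ j, 1 ≤ j → j ≤ P.K →
      ∀ (s : SeqOfRecord F θ.ν θ.τ9.M (gOfRecord₁₃ F N θ.toStage13Params P) P.K j) (V : GaugeField (F.P P.K) j (SU N)),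
      chiSeqOfRecord F N θ.ν θ.τ9.M (gOfRecord₁₃ F N θ.toStage13Params P) P.K j s V ≠ 0 →
      ∀ a ∈ cubesIn (fun a : ↥(cubeIndices (F.P P.K) (cubeSide (F.P P.K).L θ.ν.M₂ (RkOfRecord (F.P P.K).L θ.ν.r (gOfRecord₁₃ F N θ.toStage13Params P j)) j)) =>
          cubeEnl (F.P P.K) (cubeSide (F.P P.K).L θ.ν.M₂ (RkOfRecord (F.P P.K).L θ.ν.r (gOfRecord₁₃ F N θ.toStage13Params P j)) j) a 0) (s.Ω j),
        ∃ U₀, IsMinimizer (avOfRecord F N P.K) {U | PlaqSmall (θ.ν.εreg * (F.P P.K).eta j ^ 2) U}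
          (Bj θ.ν.M₁ (cubeEnl (F.P P.K) (cubeSide (F.P P.K).L θ.ν.M₂ (RkOfRecord (F.P P.K).L θ.ν.r (gOfRecord₁₃ F N θ.toStage13Params P j)) j) a 4) j)
          (avgFamily (avOfRecord F N P.K) (qsstarGIter0 j V)) U₀)
    (σ : (P : B12.RunParams) → Sect3Supplier θ P)
    (hσ : ∀ P : B12.RunParams, Step.InInterval θ.γ P.K (gOfRecord₁₃ F N θ.toStage13Params P) → SupplierObligations θ P (σ P))
    (hσB : ∀ P : B12.RunParams, Step.InInterval θ.γ P.K (gOfRecord₁₃ F N θ.toStage13Params P) → SupplierBorel θ P (σ P)) :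
    ∀ P : B12.RunParams, Step.InInterval θ.γ P.K (gOfRecord₁₃ F N θ.toStage13Params P) →
      (∀ j, j < P.K → betaOfRecord₁₃ F N θ.toStage13Params j (prefixOf (gOfRecord₁₃ F N θ.toStage13Params P) j) ≤ B) →
      Real.log (1 / gOfRecord₁₃ F N θ.toStage13Params P P.K ^ 2 + B) ≤ ((F.L ^ (F.m - a) : ℕ) : ℝ) →
      ∀ k, k ≤ P.K → SLaw₁₃CoPH F N θ P k := fun P hw hβ hfloor =>
  sLaw₁₃CoPH_all_of_supplyChainAt h.toCore hsel hθ hκ hE₀ hB₀ ((Nat.succ_le_of_lt hM₁).trans hle)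
    (supplyChainAt_of_gaussCert_of_supplierBorel_of_logScalars_of_betaLe_of_floor θ P hζ hq h hθ hM₁ hle hcR hdiv hM3 hMd hA hγ1 hγp hg3 hg2 hMa hr ha hB0 hw hβ hfloor
      (hsolv P hw) (σ P) (hσ P hw) (hσB P hw))

/-- **THE p. 245 LAWS ON EVERY WINDOW RUN ABOVE THE FLOOR — `∀ k < K, SLaw₁₃CoPH θ P k → TLaw₁₃CoPH θ P k`** (the `h11`-consequent of N11's node dictionary, same data;
dag-n11-e's `thmP245Laws_of_supplyChainAt`). [cite: Balaban1988Convergent, Theorem p.245, Thm 1 p.262, remark p.262, §3 p.279, p.257; Balaban1987RG1, (0.20) p.256, Thm 1 p.259] -/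
theorem thmP245Laws_aboveFloor_of_gaussCert_of_supplierBorel_of_logScalars
    (hζ : ∀ (p' : B12.RunParams) (n : ℕ) (Ω Λ : ℕ → Set (Site (F.P p'.K) 0)), (θ.Zh p' n Ω Λ).ζ0 = (ZhPinOfRecord₁₃ θ.toStage13Params p' Ω Λ).ζ0)
    (hq : ∀ (p' : B12.RunParams) (n : ℕ) (Ω Λ : ℕ → Set (Site (F.P p'.K) 0)) (j : ℕ) (Λ' : Set (Site (F.P p'.K) 0)) (ω : MultiCfg (F.P p'.K) (SU N) (FluctV N)),
      (θ.Zh p' n Ω Λ).quad j Λ' ω = ∑ b ∈ (Set.toFinite (bondsIn j (Λ'ᶜ ∩ Ω (j + 1)))).toFinset, ‖(ω j).2 b‖ ^ 2)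
    (h : θ.Provisos₁₃SepCoPH F N)
    (hsel : θ.ppSel = ppSelLiveOfRecord F N θ.ν θ.τ9 (EOfRecord₁₃ F N θ.toStage13Params) (wOfRecord₉ F N θ.toStage9Params))
    (hθ : θ.Admissible F N) (hκ : 0 ≤ θ.s2.lf.κ) (hE₀ : 0 ≤ θ.s2.lf.E₀) (hB₀ : 0 ≤ θ.s2.lf.B₀)
    (hM₁ : 0 < θ.ν.M₁) (hle : θ.ν.M₁ ≤ θ.τ9.M) (hcR : 2 ≤ θ.s2.cR) (hdiv : F.L * θ.ν.M₂ ∣ θ.τ9.M)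
    (hM3 : (3 * θ.ν.M₁ : ℝ) ≤ F.L * θ.ν.M₂ * (Real.log (θ.γ ^ 2)⁻¹) ^ θ.ν.r)
    (hMd : (((4 + 4) * F.L + 3 : ℕ) : ℝ) ≤ F.L * θ.ν.M₂ * (Real.log (θ.γ ^ 2)⁻¹) ^ θ.ν.r)
    (hA : 0 < θ.ν.A₀) (hγ1 : θ.γ < 1) (hγp : θ.γ ≤ Real.exp (-(θ.ν.p₀ : ℝ)))
    (hg3 : (143 * ((((8 : ℕ) : ℝ)) ^ 2 / 4) ^ 2) * (θ.γ * (θ.ν.A₀ * (Real.log (θ.γ ^ 2)⁻¹) ^ θ.ν.p₀)) ≤ 1 / 3)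
    (hg2 : 2 * (θ.γ * (θ.ν.A₀ * (Real.log (θ.γ ^ 2)⁻¹) ^ θ.ν.p₀)) ≤ 2 * ExpMeanLog.deltaSU (Fin N) / (((8 * F.L : ℕ) : ℝ)) ^ 2)
    {a : ℕ} (hMa : θ.τ9.M = F.L ^ a) (hr : θ.ν.r = 1) (ha : a ≤ F.m) {B : ℝ} (hB0 : 0 ≤ B)
    (hsolv : ∀ P : B12.RunParams, Step.InInterval θ.γ P.K (gOfRecord₁₃ F N θ.toStage13Params P) → ∀ j, 1 ≤ j → j ≤ P.K →
      ∀ (s : SeqOfRecord F θ.ν θ.τ9.M (gOfRecord₁₃ F N θ.toStage13Params P) P.K j) (V : GaugeField (F.P P.K) j (SU N)),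
      chiSeqOfRecord F N θ.ν θ.τ9.M (gOfRecord₁₃ F N θ.toStage13Params P) P.K j s V ≠ 0 →
      ∀ a ∈ cubesIn (fun a : ↥(cubeIndices (F.P P.K) (cubeSide (F.P P.K).L θ.ν.M₂ (RkOfRecord (F.P P.K).L θ.ν.r (gOfRecord₁₃ F N θ.toStage13Params P j)) j)) =>
          cubeEnl (F.P P.K) (cubeSide (F.P P.K).L θ.ν.M₂ (RkOfRecord (F.P P.K).L θ.ν.r (gOfRecord₁₃ F N θ.toStage13Params P j)) j) a 0) (s.Ω j),
        ∃ U₀, IsMinimizer (avOfRecord F N P.K) {U | PlaqSmall (θ.ν.εreg * (F.P P.K).eta j ^ 2) U}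
          (Bj θ.ν.M₁ (cubeEnl (F.P P.K) (cubeSide (F.P P.K).L θ.ν.M₂ (RkOfRecord (F.P P.K).L θ.ν.r (gOfRecord₁₃ F N θ.toStage13Params P j)) j) a 4) j)
          (avgFamily (avOfRecord F N P.K) (qsstarGIter0 j V)) U₀)
    (σ : (P : B12.RunParams) → Sect3Supplier θ P)
    (hσ : ∀ P : B12.RunParams, Step.InInterval θ.γ P.K (gOfRecord₁₃ F N θ.toStage13Params P) → SupplierObligations θ P (σ P))
    (hσB : ∀ P : B12.RunParams, Step.InInterval θ.γ P.K (gOfRecord₁₃ F N θ.toStage13Params P) → SupplierBorel θ P (σ P)) :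
    ∀ P : B12.RunParams, Step.InInterval θ.γ P.K (gOfRecord₁₃ F N θ.toStage13Params P) →
      (∀ j, j < P.K → betaOfRecord₁₃ F N θ.toStage13Params j (prefixOf (gOfRecord₁₃ F N θ.toStage13Params P) j) ≤ B) →
      Real.log (1 / gOfRecord₁₃ F N θ.toStage13Params P P.K ^ 2 + B) ≤ ((F.L ^ (F.m - a) : ℕ) : ℝ) →
      ∀ k, k < P.K → SLaw₁₃CoPH F N θ P k → TLaw₁₃CoPH F N θ P k := fun P hw hβ hfloor =>
  thmP245Laws_of_supplyChainAt h.toCore hsel hθ hκ hE₀ hB₀ ((Nat.succ_le_of_lt hM₁).trans hle)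
    (supplyChainAt_of_gaussCert_of_supplierBorel_of_logScalars_of_betaLe_of_floor θ P hζ hq h hθ hM₁ hle hcR hdiv hM3 hMd hA hγ1 hγp hg3 hg2 hMa hr ha hB0 hw hβ hfloor
      (hsolv P hw) (σ P) (hσ P hw) (hσB P hw))

end AboveFloor

end Summit.QuantumFields.YangMills.Theorems.BalabanUVNodesN11Sect3SupplyChainBorelBAboveFloor

end
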